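import Summits.ResolutionOfSingularities.ResolutionOfSingularities.Theorems.EquisingularLiftEquisingularLiftNatRatNoseTowerResolutionOfHsub
import Summits.ResolutionOfSingularities.ResolutionOfSingularities.Theorems.EquisingularLiftEquisingularLiftNatNoseTowerAssemblyV5
import Summits.ResolutionOfSingularities.ResolutionOfSingularities.Theorems.EquisingularLiftEquisingularLiftNatRationalCarrierLiftDischarge
import HarnessLib

/-!
# Route `EquisingularLift`, crux EL♮(3) (stmt-ResolutionOfSingularities-20148) — rung NOSE-TOWER₄ AT `n = 3`, CLOSED MODULO {F-102, S6@`Inv₃`} (the S6 text of the tower v7):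
# `stub_elnat_ratNoseTowerResolution_three_of_cechCtx`

[OURS · L1 W4.5(b)] res-D-pv-018 g5 (KEPT nose hand). Helper file `--supports stmt-ResolutionOfSingularities-20148 --as helper`. HONEST FRAMING: OURS; assembly of
the crux chain's own objects, NOT a statement of any manuscript; AI-written, weaker than expert review. No `sorry`; standard axioms. DEF-FREE.

WHAT. The registered stub `stub_elnat_ratNoseTowerResolution` @ `ReachNoseTower₄` (TARGET-RATNOSETOWER4.sig.txt 5929f9f170217c9c, res-L1-w45b-lead-2's fifteenth
registration) SPECIALISED TO `n = 3` (the text with `(n : ℕ)` dropped and `n ↦ 3`: `projectiveSpace 3 k`, `Fin (3 + 1)`, `ReachNoseTower₄ k 3 H ι`), PROVED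
from exactly TWO hypotheses:
* **F-102** `Literature.AlgebraicGeometry.Resolution.GenusZeroOverCompleteDVR` (named fact; res-L1-type-o6's (T-j) pack: `rationalCarrierLift_of_genusZeroOverCompleteDVR`
  p572358 discharges the assembly's residue binder `hTj : RationalCarrierLift O k θ P q` at every complete `O` with algebraically closed residue field);
* **S6** `hS6` = the Čech-witnessed-round stand-in `hCech` AT `Tower.Inv₃` — the ONE text shared by the tower v7 (`hsub_reachTower_four_of_kcl`, p576510)
  and the nose V5 (`hsub_reachNoseTowerV5_four_of`, p577961), incl. the per-round input-(c) antecedent — closed over the GLOBAL CONTEXT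
  `(k, O, θ, hθ, P, q, Y, Ch, hChStep, hChSplit, hYsp, hYirr, hYcl, hPint, hPnoeth, hPreg, hqprop, hqsm)` + `RationalCarrierLift O k θ P q` (what an S6 closer
  reads: res-L1-w45b-stub-4's `Tower.hCech₃_of_lift_sec` p576661 / its frames variant; residual (L)/(N3)/(N3′)). HONESTY: this supersedes
  `stub_elnat_ratNoseTowerResolution_three_of_cech` (p575742), whose S6 socket asked for the (Inv₂) text at ARBITRARY `(P, q, Y, Ch)` — not what any S6 closer proves.
PROOF = `stub_elnat_ratNoseTowerResolution_of_hsub₄` (INST v2, p569943) at `n = 3` fed with the supplier `fun O … => hsub_reachNoseTowerV5_four_of k O … (hTj := F-102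
discharge) (hCech := hS6 … (F-102 discharge))`. So the NOSE₄ rung at `n = 3` is a tree theorem modulo ONE named fact and ONE shared, context-closed stand-in —
the SAME board and the SAME S6 text as the tower rung `stub_elnat_coneTowerPointResolution_three_of_cechCtx`.
-/

set_option linter.dupNamespace false -- mandated namespace `Summit.<Summit>.<Problem>` of this single-conjunct summit
set_option linter.overlappingInstances false -- signatures carry `[IsDomain O] [IsDiscreteValuationRing O]`

noncomputable section

open CategoryTheory CategoryTheory.Limits AlgebraicGeometry TopologicalSpace Topology IsLocalRing
open Literature.AlgebraicGeometry.Resolution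
open AlgebraicGeometry.Scheme.IdealSheafData
open Summit.ResolutionOfSingularities.ResolutionOfSingularities.Theses.EquisingularLift.Split
open Summit.ResolutionOfSingularities.ResolutionOfSingularities.Cruxes.EquisingularLift.StrataSplit

namespace Summit.ResolutionOfSingularities.ResolutionOfSingularities.Cruxes.EquisingularLiftNat.Sections

/-- **NOSE-TOWER₄ at `n = 3`, closed modulo {F-102, S6}** (see the module docstring): TARGET-RATNOSETOWER4 specialised to `n = 3`, from the named
fact `GenusZeroOverCompleteDVR` and the S6 stand-in of the tower v7 / nose V5 (ONE text, `Tower.Inv₃`) closed over the global context.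
[folklore; pure composition of p569943 ∘ V5 ∘ p572358] [OURS · L1 W4.5b] -/
theorem stub_elnat_ratNoseTowerResolution_three_of_cechCtx (p : ℕ)
    (hF102 : Literature.AlgebraicGeometry.Resolution.GenusZeroOverCompleteDVR.{0})
    (hS6 : ∀ (k : Type) [Field k] [IsAlgClosed k]
      (O : Type) [CommRing O] [IsDomain O] [IsDiscreteValuationRing O] [IsAdicComplete (IsLocalRing.maximalIdeal O) O]
      [IsAlgClosed (IsLocalRing.ResidueField O)] (θ : O →+* k) (hθ : Function.Surjective θ)
      (P : Scheme.{0}) (q : P ⟶ Spec (.of O)) (Y : Set P) (Ch : ∀ X' : Scheme.{0}, (X' ⟶ P) → Set X' → Prop)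
      (hChStep : ∀ (X' X'' : Scheme.{0}) (σ' : X' ⟶ P) (S' : Set X') (C : X'.IdealSheafData) (τ : X'' ⟶ X'),
        Ch X' σ' S' → IsBlowup τ C → Scheme.IsRegular C.subscheme → Flat (C.subschemeι ≫ σ' ≫ q) →
        σ' '' (C.support : Set X') ⊆ {y | ¬ IsGenericPoint y Y} → (C.support : Set X') ∩ (σ' ≫ q) ⁻¹' {IsLocalRing.closedPoint O} ⊆ S' →
        Ch X'' (τ ≫ σ') (closure (τ ⁻¹' (S' \ (C.support : Set X')))))
      (hChSplit : ∀ (X' : Scheme.{0}) (σ' : X' ⟶ P) (S' : Set X'), Ch X' σ' S' → Chain P Y X' σ' S')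
      (hYsp : Y ⊆ q ⁻¹' {IsLocalRing.closedPoint O}) (hYirr : IsIrreducible Y) (hYcl : IsClosed Y) (hPint : IsIntegral P)
      (hPnoeth : IsLocallyNoetherian P) (hPreg : Scheme.IsRegular P) (hqprop : IsProper q) (hqsm : SmoothOfRelativeDimension 3 q),
      RationalCarrierLift O k θ P q →
      ∀ {F₉ : Scheme.{0}} (Z₉ : Set F₉) (hZ₉ : IsClosed Z₉) {F₁₀ : Scheme.{0}} (υ' : F₁₀ ⟶ F₉)
          (G G' : Scheme.{0}) (γ : G ⟶ F₁₀) (T E K : Set G) (hE : IsClosed E) (Z : Set G) (hZ : IsClosed Z) (υ₂ : G' ⟶ G) (K' : Set G'),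
          (Tower.Inv₃ O k θ P q Y Ch (DirLift.Ruled O k θ P q Y) F₉ Z₉ hZ₉ F₁₀ υ' G γ T E K ∧ IsClosed K ∧ K ⊆ closure (K \ E) ∧ K ≠ Set.univ) →
          Z ⊆ E ∩ T → Z.Nonempty → TowerFull F₉ F₁₀ υ' Z₉ hZ₉ G γ Z hZ →
          (DirStepSec F₉ F₁₀ υ' Z₉ hZ₉ G γ Z hZ ∧ RationalCarrier (redSub F₉ Z₉ hZ₉) ∧
            (∀ x : redSub G Z hZ, IsRegularLocalRing (G.presheaf.stalk (redSubι G Z hZ x))) ∧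
            (∀ (i : redSub G Z hZ ⟶ redSub G E hE), i ≫ redSubι G E hE = redSubι G Z hZ →
              ∀ x : redSub G Z hZ, IsRegularLocalRing ((redSub G E hE).presheaf.stalk (i x))) ∧ DirStepUnobs G E hE Z hZ) →
          -- input (c) AT THIS ROUND, handed to the S6 closer (v7: DERIVED at the call site from the carrier datum of `INV₁` through the section iso —
          -- replaces the refutable closer-level `hFrameAll` of p575157): quasi-regular 2-frames of every regular `O`-flat centre with trace `𝓘⟨Z⟩`
          (∀ (X : Scheme.{0}) (σ : X ⟶ P) (S : Set X) (jG : G ⟶ X) (tG : G ⟶ Spec (.of k)) (𝒞 : X.IdealSheafData),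
            Ch X σ S → IsIntegral X → IsLocallyNoetherian X → Scheme.IsRegular X → IsDominant (σ ≫ q) →
            IsPullback jG tG (σ ≫ q) (Spec.map (CommRingCat.ofHom θ)) → jG '' T = S →
            𝒞.comap jG = vanishingIdeal ⟨Z, hZ⟩ → Flat (𝒞.subschemeι ≫ σ ≫ q) → Scheme.IsRegular 𝒞.subscheme →
            ∀ x ∈ 𝒞.support, ∃ c : Fin 2 → X.presheaf.stalk x, Ideal.span (Set.range c) = stalkIdeal 𝒞 x ∧ IsQuasiRegular c) →
          IsBlowup υ₂ (vanishingIdeal (⟨Z, hZ⟩ : Closeds G)) →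
          (K' = ∅ ∨ ((ConeWitness G E hE K Z hZ ∨ closure (Z \ closure K) = Z) ∧ K' = closure (υ₂ ⁻¹' (K \ Z)))) →
          (Tower.Inv₃ O k θ P q Y Ch (DirLift.Ruled O k θ P q Y) F₉ Z₉ hZ₉ F₁₀ υ' G' (υ₂ ≫ γ) (closure (υ₂ ⁻¹' (T \ Z))) (υ₂ ⁻¹' Z) K' ∧
              IsClosed K' ∧ K' ⊆ closure (K' \ υ₂ ⁻¹' Z) ∧ K' ≠ Set.univ) ∧
            (Tower.Inv₃ O k θ P q Y Ch (DirLift.Ruled O k θ P q Y) F₉ Z₉ hZ₉ F₁₀ υ' G' (υ₂ ≫ γ) (closure (υ₂ ⁻¹' (T \ Z))) (closure (υ₂ ⁻¹' (E \ Z))) K' ∧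
              IsClosed K' ∧ K' ⊆ closure (K' \ closure (υ₂ ⁻¹' (E \ Z))) ∧ K' ≠ Set.univ)) :
    p.Prime → ∀ (k : Type) [Field k] [CharP k p] [IsAlgClosed k] (H : AlgebraicGeometry.Scheme.{0}) (ι : H ⟶ (Literature.AlgebraicGeometry.Motives.projectiveSpace 3 k).left), AlgebraicGeometry.IsClosedImmersion ι → AlgebraicGeometry.IsIntegral H → (∀ y : (Literature.AlgebraicGeometry.Motives.projectiveSpace 3 k).left, ∃ U : (Literature.AlgebraicGeometry.Motives.projectiveSpace 3 k).left.affineOpens, y ∈ (U : (Literature.AlgebraicGeometry.Motives.projectiveSpace 3 k).left.Opens) ∧ (ι.ker.ideal U).IsPrincipal) → (ReachNoseTower₄ k 3 H ι) → ∃ (O : Type) (_ : CommRing O) (_ : IsDomain O) (_ : IsDiscreteValuationRing O) (_ : CharZero O) (π : O →+* k), Function.Surjective π ∧ (letI := MvPolynomial.gradedAlgebra (σ := Fin (3 + 1)) (R := O); letI := MvPolynomial.gradedAlgebra (σ := Fin (3 + 1)) (R := k); ∀ (φ : MvPolynomial.homogeneousSubmodule (Fin (3 + 1)) O →+*ᵍ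 MvPolynomial.homogeneousSubmodule (Fin (3 + 1)) k) (hφ' : HomogeneousIdeal.irrelevant (MvPolynomial.homogeneousSubmodule (Fin (3 + 1)) k) ≤ (HomogeneousIdeal.irrelevant (MvPolynomial.homogeneousSubmodule (Fin (3 + 1)) O)).map φ), (∀ s, φ s = MvPolynomial.map π s) → ∀ Y : Set (AlgebraicGeometry.Proj (MvPolynomial.homogeneousSubmodule (Fin (3 + 1)) O)), Y = Set.range (CategoryTheory.CategoryStruct.comp ι (AlgebraicGeometry.Proj.map φ hφ') : H ⟶ (AlgebraicGeometry.Proj (MvPolynomial.homogeneousSubmodule (Fin (3 + 1)) O))) → ∃ (P' : AlgebraicGeometry.Scheme.{0}) (σ : P' ⟶ (AlgebraicGeometry.Proj (MvPolynomial.homogeneousSubmodule (Fin (3 + 1)) O))) (S' : Set P'), (∀ Q : (∀ X' : AlgebraicGeometry.Scheme.{0}, (X' ⟶ (AlgebraicGeometry.Proj (MvPolynomial.homogeneousSubmodule (Fin (3 + 1)) O))) → Set X' → Prop), Q (AlgebraicGeometry.Proj (MvPolynomial.homogeneousSubmodule (Fin (3 + 1)) O)) (CategoryTheory.CategoryStruct.id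 _) Y → (∀ (X' X'' : AlgebraicGeometry.Scheme.{0}) (σ' : X' ⟶ (AlgebraicGeometry.Proj (MvPolynomial.homogeneousSubmodule (Fin (3 + 1)) O))) (Y' : Set X') (C : X'.IdealSheafData) (τ : X'' ⟶ X'), Q X' σ' Y' → Literature.AlgebraicGeometry.Resolution.IsBlowup τ C → Literature.AlgebraicGeometry.Resolution.Scheme.IsRegular C.subscheme → AlgebraicGeometry.Flat (CategoryTheory.CategoryStruct.comp C.subschemeι (CategoryTheory.CategoryStruct.comp σ' (CategoryTheory.CategoryStruct.comp (AlgebraicGeometry.Proj.toSpecZero (MvPolynomial.homogeneousSubmodule (Fin (3 + 1)) O)) (AlgebraicGeometry.Spec.map (CommRingCat.ofHom (algebraMap O (MvPolynomial.homogeneousSubmodule (Fin (3 + 1)) O 0))))))) → σ' '' (C.support : Set X') ⊆ {x | ¬ IsGenericPoint x Y} → (C.support : Set X') ∩ (CategoryTheory.CategoryStruct.comp σ' (CategoryTheory.CategoryStruct.comp (AlgebraicGeometry.Proj.toSpecZero (MvPolynomial.homogeneousSubmodule (Fin (3 + 1)) O)) (AlgebraicGeometry.Spec.map (CommRingCat.ofHom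 (algebraMap O (MvPolynomial.homogeneousSubmodule (Fin (3 + 1)) O 0)))))) ⁻¹' {IsLocalRing.closedPoint O} ⊆ Y' → Q X'' (CategoryTheory.CategoryStruct.comp τ σ') (closure (τ ⁻¹' (Y' \ (C.support : Set X'))))) → Q P' σ S') ∧ Literature.AlgebraicGeometry.Resolution.Scheme.IsRegular (AlgebraicGeometry.Scheme.IdealSheafData.vanishingIdeal (⟨closure S', isClosed_closure⟩ : TopologicalSpace.Closeds P')).subscheme) := by
  intro hp k _ _ _ H ι hι hH hloc hreach
  exact stub_elnat_ratNoseTowerResolution_of_hsub₄ p hp k 3 H ι hι hH hloc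
    (fun O _ _ _ _ _ θ hθ P q Y Ch hChStep hChSplit hYsp hYirr hYcl hPint hPnoeth hPreg hqprop hqsm X' σ' S' hCh' hX'int hX'noeth hX'reg hX'dom F₁ hF₁ j t hsq T₁ hT₁cl hT₁irr hjT₁ Z hZ hZT₁ hT₁Z hZinf hZP1 C hCsm hCreg hCfl hCj hCoff X₁ τ₁ hτ₁ hX₁int hX₁noeth hX₁reg hX₁dom F₂ hF₂ υ hυ j₂ t₂ hsq₂ hcomm hexc hirr₂ hCh₁ F' γ' T' E' K' hcl =>
      hsub_reachNoseTowerV5_four_of k O θ hθ P q Y Ch hChStep hChSplit hYsp hYirr hYcl hPint hPnoeth hPreg hqprop hqsm X' σ' S' hCh' hX'int hX'noeth hX'reg hX'dom F₁ hF₁ j t hsq T₁ hT₁cl hT₁irr hjT₁ Z hZ hZT₁ hT₁Z hZinf hZP1 C hCsm hCreg hCfl hCj hCoff X₁ τ₁ hτ₁ hX₁int hX₁noeth hX₁reg hX₁dom F₂ hF₂ υ hυ j₂ t₂ hsq₂ hcomm hexc hirr₂ hCh₁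
        (rationalCarrierLift_of_genusZeroOverCompleteDVR hF102 hθ)
        (hS6 k O θ hθ P q Y Ch hChStep hChSplit hYsp hYirr hYcl hPint hPnoeth hPreg hqprop hqsm
          (rationalCarrierLift_of_genusZeroOverCompleteDVR hF102 hθ)) F' γ' T' E' K' hcl)
    hreach

end Summit.ResolutionOfSingularities.ResolutionOfSingularities.Cruxes.EquisingularLiftNat.Sections

end
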